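import Summits.QuantumAdvantage.QuantumAdvantage.Theorems.CubicForrelationNearExactIsExactTwelveLevelFivePartnerGe2932
import Summits.QuantumAdvantage.QuantumAdvantage.Theorems.CubicForrelationNearExactIsExactTwelveTypeO512At2932

/-!
# Crux `CubicForrelation.NearExactIsExact` (stmt-QuantumAdvantage-14043) — n = 12, a GENERIC level-5 side AT `Φ = 29/32`: its partner is a type-O
  side of base `768` or `896` (level-5 / level-`≥ 6` partners and the type-O bases `512, 960, 992, 1024` are all excluded)

Certificate seat `b2b-cforr-cert` (gen 22).  HONEST FRAMING: kernel-checked consequences (standard axioms, no `decide`) of `tw22_levelFive_ge2932_partner`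
(…TwelveLevelFivePartnerGe2932) for the boundary rung `29/32` at `n = 12` (HOME/b2b-cforr-cert-g22/PLAN-N12-928-EQ.md).  A level-5 side `g`
(`W_g = 32u'`, some `u'` odd) is GENERIC when the pair is exact off the odd hyperplane and round 1 of the cascade has passed (`8 ∣ u' − 2(−1)^f − (−1)^D`
on the odd set, `D` quadratic; the two rigid alternatives are …RoundOneGe2932's first case and the off-`P`-energy-`1024` case, NOT treated here).
NO new value of `θ₁₂`.  NOT summit progress.

* `tw22_levelFive_generic_levelFive_partner_false`, `tw22_levelFive_generic_levelSix_partner_false`: the partner of a generic level-5 side at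
  `Φ ≥ 29/32` is type O (`tw22_levelFive_ge2932_partner`), so it is neither a level-5 nor a level-`≥ 6` side.
* `tw22_levelFive_generic_partner_base`: the type-O partner `f` has base set `#E_f ∈ {768, 896}`: its residual has a spike `|u_f − 4(−1)^g| ≥ 23`,
  i.e. a wild point of height `|v| ≥ 3`, whose excess is `≥ 529 − 9 = 520`; with the budget `4096 + 8·#E_f + X ≤ 12288` (`to21_typeO_ge2932_shape`)
  this leaves `#E_f ∈ {512, 768, 896}`, and `512` is excluded by `to22_typeO_E512_ge2932_dichotomy` (at `Φ ≥ 929/1024` by `to20_typeO_E512_ge929_false`;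
  at `Φ = 29/32` all wild points have height `1`, so `|u_f − 4(−1)^g| ≤ 11`).

References: J. Ax (1964) / R. J. McEliece (1972); Kasami–Tokura (1970); MacWilliams–Sloane (1977) Ch. 13–15.  Axioms: the standard three.
-/

set_option linter.dupNamespace false -- D-0017: single-problem summit ⇒ `QuantumAdvantage.QuantumAdvantage` by design

noncomputable section

namespace Summit.QuantumAdvantage.QuantumAdvantage.Theorems.CubicForrelation.NearExactIsExact

open Finset
open Literature.Computability.QuantumComplexity
open Literature.Computability.QuantumComplexity.DerivativeWalsh (W)
open Summit.QuantumAdvantage.QuantumAdvantage.Theorems.NearExactIsExact.Negative (TypeOTwelve.typeO_of_exists_odd)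

/-- **Generic level 5 × level 5 is dead at `Φ ≥ 29/32`** (12 bits): the partner of a generic level-5 side is type O.  NOT summit progress.
[this work] -/
theorem tw22_levelFive_generic_levelFive_partner_false (f g : (Fin (6 + 6) → Bool) → Bool) (hf : IsDegLeFun 3 f) (hg : IsDegLeFun 3 g)
    (u' : (Fin (6 + 6) → Bool) → ℤ) (hu' : ∀ x, W (fun y => signOf (g y)) x = (2 : ℝ) ^ 5 * (u' x : ℝ))
    (hodd : ∃ x, Odd (u' x)) (hΦ : (29 / 32 : ℝ) ≤ forrelation f g)
    (hoff : ∀ y, ¬ Odd (u' y) → u' y = 2 * sZ (f y))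
    (D : (Fin (6 + 6) → Bool) → Bool) (hD : IsDegLeFun 2 D) (h8 : ∀ x, Odd (u' x) → (8 : ℤ) ∣ u' x - 2 * sZ (f x) - sZ (D x))
    (uf' : (Fin (6 + 6) → Bool) → ℤ) (huf' : ∀ y, W (fun x => signOf (f x)) y = (2 : ℝ) ^ 5 * (uf' y : ℝ)) (hoddf : ∃ y, Odd (uf' y)) :
    False := by
  obtain ⟨uf, huf, hO, -⟩ := tw22_levelFive_ge2932_partner f g hf hg u' hu' hodd hΦ hoff D hD h8
  obtain ⟨y, hy⟩ := hoddf
  have heq : uf y = 2 * uf' y := by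
    have h := (huf y).symm.trans (huf' y)
    have h' : ((uf y : ℤ) : ℝ) = ((2 * uf' y : ℤ) : ℝ) := by
      push_cast
      have h2 : (2 : ℝ) ^ 4 ≠ 0 := by norm_num
      have : (2 : ℝ) ^ 4 * (uf y : ℝ) = (2 : ℝ) ^ 4 * (2 * (uf' y : ℝ)) := by rw [h]; ring
      exact mul_left_cancel₀ h2 this
    exact_mod_cast h'
  have := hO y
  rw [heq] at this
  exact Int.not_even_iff_odd.2 this ⟨uf' y, two_mul _⟩

/-- **Generic level 5 × level `≥ 6` is dead at `Φ ≥ 29/32`** (12 bits).  NOT summit progress. [this work] -/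
theorem tw22_levelFive_generic_levelSix_partner_false (f g : (Fin (6 + 6) → Bool) → Bool) (hf : IsDegLeFun 3 f) (hg : IsDegLeFun 3 g)
    (u' : (Fin (6 + 6) → Bool) → ℤ) (hu' : ∀ x, W (fun y => signOf (g y)) x = (2 : ℝ) ^ 5 * (u' x : ℝ))
    (hodd : ∃ x, Odd (u' x)) (hΦ : (29 / 32 : ℝ) ≤ forrelation f g)
    (hoff : ∀ y, ¬ Odd (u' y) → u' y = 2 * sZ (f y))
    (D : (Fin (6 + 6) → Bool) → Bool) (hD : IsDegLeFun 2 D) (h8 : ∀ x, Odd (u' x) → (8 : ℤ) ∣ u' x - 2 * sZ (f x) - sZ (D x))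
    (wf : (Fin (6 + 6) → Bool) → ℤ) (hwf : ∀ y, W (fun x => signOf (f x)) y = (2 : ℝ) ^ 6 * (wf y : ℝ)) : False := by
  obtain ⟨uf, huf, hO, -⟩ := tw22_levelFive_ge2932_partner f g hf hg u' hu' hodd hΦ hoff D hD h8
  obtain ⟨x₀, -⟩ := hodd
  have heq : uf x₀ = 4 * wf x₀ := by
    have h := (huf x₀).symm.trans (hwf x₀)
    have h' : ((uf x₀ : ℤ) : ℝ) = ((4 * wf x₀ : ℤ) : ℝ) := by
      push_cast
      have h2 : (2 : ℝ) ^ 4 ≠ 0 := by norm_num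
      have : (2 : ℝ) ^ 4 * (uf x₀ : ℝ) = (2 : ℝ) ^ 4 * (4 * (wf x₀ : ℝ)) := by rw [h]; ring
      exact mul_left_cancel₀ h2 this
    exact_mod_cast h'
  have := hO x₀
  rw [heq] at this
  exact Int.not_even_iff_odd.2 this ⟨2 * wf x₀, by ring⟩

/-- **The type-O partner of a generic level-5 side at `Φ ≥ 29/32` has base set `768` or `896`** (12 bits).  See the module docstring.
Finite-slice statement, NOT summit progress. [this work] -/
theorem tw22_levelFive_generic_partner_base (f g : (Fin (6 + 6) → Bool) → Bool) (hf : IsDegLeFun 3 f) (hg : IsDegLeFun 3 g)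
    (u' : (Fin (6 + 6) → Bool) → ℤ) (hu' : ∀ x, W (fun y => signOf (g y)) x = (2 : ℝ) ^ 5 * (u' x : ℝ))
    (hodd : ∃ x, Odd (u' x)) (hΦ : (29 / 32 : ℝ) ≤ forrelation f g)
    (hoff : ∀ y, ¬ Odd (u' y) → u' y = 2 * sZ (f y))
    (D : (Fin (6 + 6) → Bool) → Bool) (hD : IsDegLeFun 2 D) (h8 : ∀ x, Odd (u' x) → (8 : ℤ) ∣ u' x - 2 * sZ (f x) - sZ (D x)) :
    ∃ uf : (Fin (6 + 6) → Bool) → ℤ, (∀ y, W (fun x => signOf (f x)) y = (2 : ℝ) ^ 4 * (uf y : ℝ)) ∧ (∀ y, Odd (uf y)) ∧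
      (#(univ.filter fun y : Fin (6 + 6) → Bool => (Odd (uf y / 2) ↔ Odd (uf y / 2 / 2))) = 768 ∨
       #(univ.filter fun y : Fin (6 + 6) → Bool => (Odd (uf y / 2) ↔ Odd (uf y / 2 / 2))) = 896) := by
  classical
  have hΦ' : forrelation g f = forrelation f g := by
    rw [Summit.QuantumAdvantage.QuantumAdvantage.Theorems.SignedCubicForrelationNotPrBPP.Negative.HalfQuad.forrelation_comm]
  have hlo' : (29 / 32 : ℝ) ≤ forrelation g f := by rw [hΦ']; exact hΦ
  obtain ⟨uf, huf, hO, y₀, hy₀⟩ := tw22_levelFive_ge2932_partner f g hf hg u' hu' hodd hΦ hoff D hD h8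
  refine ⟨uf, huf, hO, ?_⟩
  have hoddf : ∃ y, Odd (uf y) := ⟨y₀, hO y₀⟩
  -- the shape of the type-O side `f` (partner `g`)
  obtain ⟨hshape, hge, hle, -⟩ := to21_typeO_ge2932_shape g f hf uf huf hoddf hlo'
  set Ef := univ.filter (fun y : Fin (6 + 6) → Bool => (Odd (uf y / 2) ↔ Odd (uf y / 2 / 2))) with hEfdef
  -- the wild decomposition of `f`'s residual and the spike's excess
  choose v hv using fun y => to12_pt_mod8 (uf y) (sZ (g y)) (hO y) (tp_sZ_cases (g y))
  set τ₀ : (Fin (6 + 6) → Bool) → ℤ := fun y =>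
    sZ (decide (Odd (uf y / 2))) * (1 - 4 * (if (Odd (uf y / 2) ↔ Odd (uf y / 2 / 2)) then 1 else 0)) with hτ₀def
  have hτ₀val : ∀ y, τ₀ y = 1 ∨ τ₀ y = -1 ∨ τ₀ y = 3 ∨ τ₀ y = -3 := by
    intro y
    simp only [τ₀]
    rcases tp_sZ_cases (decide (Odd (uf y / 2))) with h | h <;> rw [h] <;> split_ifs <;> norm_num
  have hτ₀sq : ∀ y, τ₀ y ^ 2 = 1 + 8 * (if (Odd (uf y / 2) ↔ Odd (uf y / 2 / 2)) then 1 else 0 : ℤ) := by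
    intro y
    simp only [τ₀]
    rcases tp_sZ_cases (decide (Odd (uf y / 2))) with h | h <;> rw [h] <;> split_ifs <;> norm_num
  have hsumE : (∑ y, (if (Odd (uf y / 2) ↔ Odd (uf y / 2 / 2)) then 1 else 0 : ℤ)) = #Ef := by rw [sum_boole]
  have hsumτ₀ : ∑ y, τ₀ y ^ 2 = 4096 + 8 * #Ef := by
    rw [sum_congr rfl fun y _ => hτ₀sq y, sum_add_distrib, ← mul_sum, hsumE, sum_const, card_univ, Fintype.card_fun,
      Fintype.card_bool, Fintype.card_fin]
    norm_num
  set X : (Fin (6 + 6) → Bool) → ℤ := fun y => (τ₀ y + 8 * v y) ^ 2 - τ₀ y ^ 2 with hXdef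
  have hXnn : ∀ y, 0 ≤ X y := fun y => to12_excess_nonneg _ _ (hτ₀val y)
  have hTdec : (∑ y, (uf y - 4 * sZ (g y)) ^ 2 : ℤ) = ∑ y, τ₀ y ^ 2 + ∑ y, X y := by
    rw [← sum_add_distrib]
    exact sum_congr rfl fun y _ => by rw [hv y]; simp only [X]; ring
  -- the spike costs at least `520`
  have hX₀ : 520 ≤ X y₀ := by
    have h23 := hy₀
    rw [hv y₀] at h23
    have hsq : (529 : ℤ) ≤ (τ₀ y₀ + 8 * v y₀) ^ 2 := by
      have h1 : |τ₀ y₀ + 8 * v y₀| ^ 2 = (τ₀ y₀ + 8 * v y₀) ^ 2 := sq_abs _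
      nlinarith [abs_nonneg (τ₀ y₀ + 8 * v y₀)]
    have ht9 : τ₀ y₀ ^ 2 ≤ 9 := by rcases hτ₀val y₀ with h | h | h | h <;> rw [h] <;> norm_num
    simp only [X]
    linarith
  have hXsum : 520 ≤ ∑ y, X y := le_trans hX₀ (single_le_sum (fun y _ => hXnn y) (mem_univ y₀))
  -- so `#E_f ≤ 959`
  have hEf : #Ef ≤ 959 := by
    have : 4096 + 8 * (#Ef : ℤ) + 520 ≤ 12288 := by rw [hTdec, hsumτ₀] at hle; linarith
    have : (#Ef : ℤ) ≤ 959 := by linarith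
    exact_mod_cast this
  rcases hshape with h | h | h | h | h | ⟨h, -⟩
  · -- base `512`: either `Φ ≥ 929/1024` (dead) or all wild points have height `1` (no spike)
    exfalso
    rcases to22_typeO_E512_ge2932_dichotomy g f hg hf uf huf hoddf h hlo' with h929 | ⟨-, v', hv', hv'val, -⟩
    · exact to20_typeO_E512_ge929_false g f hg hf uf huf hoddf h h929
    · have h1 := hv' y₀
      have h23 := hy₀
      rw [h1] at h23
      have ht : -3 ≤ τ₀ y₀ ∧ τ₀ y₀ ≤ 3 := by rcases hτ₀val y₀ with h | h | h | h <;> rw [h] <;> norm_num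
      change 23 ≤ |τ₀ y₀ + 8 * v' y₀| at h23
      rw [le_abs] at h23
      rcases hv'val y₀ with h0 | ⟨h0, -⟩
      · rw [h0] at h23; rcases h23 with h23 | h23 <;> linarith
      · rcases h0 with h0 | h0 <;> rw [h0] at h23 <;> rcases h23 with h23 | h23 <;> linarith
  · exact Or.inl h
  · exact Or.inr h
  · exfalso; rw [h] at hEf; norm_num at hEf
  · exfalso; rw [h] at hEf; norm_num at hEf
  · exfalso; rw [h] at hEf; norm_num at hEf

end Summit.QuantumAdvantage.QuantumAdvantage.Theorems.CubicForrelation.NearExactIsExact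

end
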